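import Literature.MathematicalPhysics.QuantumFieldTheory.Balaban1983to89.B9Eq326ConjugatedDeltaATower
import Literature.MathematicalPhysics.QuantumFieldTheory.Balaban1983to89.B9Eq349BondBlockDecayFromCircle
import Literature.MathematicalPhysics.QuantumFieldTheory.Balaban1983to89.B9Eq3101ExpPointwiseMultiplier

/-!
# `Balaban1983to89.B9Eq326DeltaABlockDecayTower` — T. Bałaban, *Propagators for lattice gauge theories in a background field*, Commun. Math. Phys. **99**
# (1985) 389–434 [Balaban1985BackgroundPropagators] (3.26) p. 395 (with (3.16)∕(3.24) pp. 393–394), Thm 3.11 p. 416 *«… Δ_a, G are positive … the kernels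
# … decay exponentially»*, (3.49) p. 399, with [Balaban1985Variational] (110) p. 294: **THE BIG-BLOCK `L²` DECAY OF THE `k`-LEVEL BOND PROPAGATOR
# `G₁,k(U) = Δ_{a,k}(U)⁻¹` ON `towerP L m (n+1)` — `‖P_{y₁} ∘ G₁,k(U) ∘ P_{y₀}‖ ≤ (4∕γ)·e^{r}·e^{−r·d_m(y₀,y₁)}` AT EVERY HEIGHT `n`** for the bond
# big-blocks `P_y` (bonds based in the big block `B(y)`, `Π = blockCoord (L^{n+1}) m ∘ siteCast ∘ bpos`), from the circle form of
# `B9Eq326ConjugatedDeltaATower.norm_conjG1k_le` and this lineage's bonds→bonds read-out WITH COMPANION WEIGHT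
# `B9Eq349BondBlockDecayFromCircle.norm_bondBlock_le_exp_of_uniform_circle_bound_cast` along `towerP_eq_fineP_pow` — the TOWER PORT of `B9Eq326DeltaABlockDecay`
# (v2): the (D-E)k-shaped letter of `G₁,k(U)` itself, reached WITHOUT a gradient row and WITHOUT the Schur complement; letters displayed uniformly over the fine
# weights `χ`, their coarse companions `χ′` and the circle IN THE SHAPE OF `B9Eq3126QG1QInvPointDecayTower`'s `hQK` (`dQ` with `e^{κM_F}Q_ke^{−κM_B}`, `dQ′` with
# `e^{κM_B}Q_k†e^{−κM_F}`, `dK`, `dR`): `γ` (Thm 3.11 at `k` levels), `p_K`, `β_K`, the conjugated `Q_k(U)` letters (supplier: t4-ne9-p1's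
# `B9Eq349ConjugatedQTowerLetters`), `ρ`, and `C_P`

statement-level skeleton of published theorems with citation tags; proofs where landed; nothing here is a claim about the Yang–Mills mass gap

CITATION HEADER (lean-in-tree rule).  Audit cell `pub-balaban`, sub-cell `t4`, BINDER row NE9; filed by NE9 formalisation-swarm leaf prover 03
(`b2b-balaban-t4-ne9-formalise-leaf-03`, gen 76; v1 of gen 75 imported the NE9 owner's (D0-d) `B9Eq326LocalPartBlockDecay` and displayed the `Q_k` letter in
factorised `∃ Q_κ Q′_κ` form — v2 reads the block decay out of `B9Eq349BondBlockDecayFromCircle` and builds `Q_κ`, `Q′_κ` itself).  Imports this lineage's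
`B9Eq326ConjugatedDeltaATower` and `B9Eq349BondBlockDecayFromCircle` (through it `B9Eq316TowerFlatIsOneStep`'s `siteCast`, `towerP_eq_fineP_pow`), road B8″'s (G)
`B9Eq3101ExpPointwiseMultiplier`.  Proof text = the one-step file's §1∕§2 (CREDIT for the pattern: t4-ne9-p1 g92's (D0-d)).  Sources READ first-hand: [Balaban1985BackgroundPropagators]
p. 395 (3.26), pp. 393–394 (3.16)∕(3.24), p. 416 Thm 3.11, p. 399 (3.49); [Balaban1985Variational] p. 294 (110).  Print's road is the random walk of Sect. C
with local gauge fixing; the conjugation is the ROUTE's Combes–Thomas substitute; nothing of print's rate is asserted.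

WHAT IS PROVED (sorry-free; proof lane — no `def`; [folklore] composition BY NAME).
* §1 **`norm_conjG1k_le_of_circle`** — at one `κ` of the circle: `‖exp(κ•M_B) ∘ G₁,k(U) ∘ exp(−κ•M_B)‖ ≤ 4∕γ` from `norm_conjG1k_le` at the operator exponentials
  of the fine multipliers with `Q_κ := e^{κM_F}Q_ke^{−κM_B}`, `Q′_κ := e^{κM_B}Q_k†e^{−κM_F}`, the four letters `dQ, dQ′, dK, dR` displayed, every height `n`.
* §2 **`norm_block_G1k_le`** — THE INSTANCE at the diagonal `ηL^{n+1} = 1` (`1 ≤ ℓ`, `1 ≤ ℓ′`), every height `n`, the letters supplied uniformly over `χ`, the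
  companions `χ′` (block condition read through `siteCast`) and the circle: `‖P_{y₁} ∘ G₁,k(U) ∘ P_{y₀}‖ ≤ (4∕γ)·e^{r}·e^{−r·d_m(y₀,y₁)}`.
HONEST SCOPE.  Composition; displayed per height: `γ`, `p_K`, `β_K`, the `Q_k(U)` letters, `ρ`, `C_P` (their `k`-level suppliers = the tower twins of
`B9Eq349ConjugatedProjectionDifferenceChain` ∕ `B9Eq325ProjectionDivergenceQuarterKappa` over `B9Eq349ConjugatedProjectionChainTower` — next bricks);
rate `r` = whatever the windows allow; NO `∃` before the height yet (the `∃`-closing needs the displayed letters' level-free suppliers); nothing of [B9] Thm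
3.1∕3.3∕3.11 asserted, valued or discharged; «NE9 ⇐ the named binders»; NE9 NOT PRINTED ∕ NOT PROVED; row WALLED ON A MODEL (O-NE9-1; #5 UNRULED); spine
PROVED 0∕9; rung (B)+1 on a finite T⁴ — NOT infinite volume, NOT mass gap, NOT BetaPertH, NOT Clay.  HONEST DEPENDENCY: continuum YM on T⁴ ⇐ BetaPertH ∧ nine
spine estimates (0/9 proved); BetaPertH ⇐ (D1) ∧ (D4) ∧ CAP+tail.  NEW file; nothing modified.  Net new unproved facts: 0.
-/

noncomputable section

set_option autoImplicit false

open scoped InnerProductSpace ComplexConjugate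
open NormedSpace

namespace Literature.MathematicalPhysics.QuantumFieldTheory.Balaban1983to89.B9Eq326DeltaABlockDecayTower

open B4Sect5Torus (TSite tdist)
open B9SectCLatticeCarrier (Bond bpos btgt)
open B9Eq311L2Pairing (WL2)
open B9Eq319QprimeTorus (fineP blockCoord)
open B9Eq315QTower (towerP)
open B9Eq315QTorus (perCfg cornerSite)
open B7Prop1Explicit (Wcx boxVec)
open B9Eq316TowerFlatIsOneStep (siteCast siteCast_rfl towerP_eq_fineP_pow)
open B7Prop1Explicit (U1)
open B11Eq103H1Complex (SiteL2K BondL2K covDivL2K)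
open B9Eq310HessianOperator (adTransportW PlaqL2K curvOp)
open B9Eq326OperatorTower (laplaceAk RofUk G1k QkW)
open B9Eq326ConjugatedDeltaATower (norm_conjG1k_le apply_inv_apply')
open B9Eq349BondBlockDecayFromCircle (norm_bondBlock_le_exp_of_uniform_circle_bound_cast)
open B9Eq3101ExpPointwiseMultiplier (equiv_exp_smul_apply_complex equiv_exp_smul_neg_apply_complex)
open B9Eq387IMSLocalLettersLattice (exists_pointwise_clm)

/-! ## §1 The circle form of the conjugated bound for `G₁(U)` -/

section Circle

variable {d : ℕ} (L : ℕ) [NeZero L] (m : Fin d → ℕ) [∀ i, NeZero (m i)] (n : ℕ)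
  {𝔸 : Type*} [NormedRing 𝔸] [StarRing 𝔸] [NormedAlgebra ℂ 𝔸] [StarModule ℂ 𝔸] [CompleteSpace 𝔸] [NormOneClass 𝔸]
  {W : Type*} [NormedAddCommGroup W] [InnerProductSpace ℂ W] [FiniteDimensional ℂ W] (φ : W ≃ₗ[ℂ] 𝔸) {Mφ Mφ' : ℝ}
  (hφ : ∀ w, ‖φ w‖ ≤ Mφ * ‖w‖) (hφ' : ∀ X, ‖φ.symm X‖ ≤ Mφ' * ‖X‖) (hMφ : 0 ≤ Mφ) (hMφ' : 0 ≤ Mφ')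
  {c₀ : ℝ} [Fact (0 < c₀)] {c₁ : ℝ} [Fact (0 < c₁)] {η : ℝ} (hη : 0 < η) (U : Bond d (towerP L m (n + 1)) → 𝔸ˣ) (hU : ∀ b, U b ∈ U1 𝔸)
  (hRS : ∀ (b : Bond d (towerP L m (n + 1))) (v u : W), ⟪adTransportW φ U b v, u⟫_ℂ = ⟪v, adTransportW φ (fun b => (U b)⁻¹) b u⟫_ℂ)
  (τ : 𝔸 →ₗ[ℂ] ℂ) (hL : 1 ≤ L) (α : ℕ → ℝ) (hα1 : ∀ j, α j ≤ 1 / 64)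
  (hU1 : ∀ (j : ℕ) (x : B7Prop1Explicit.Site d) (κ : Fin d), perCfg (towerP L m (j + 1)) (B9Eq315QTower.UlevOf L m (n + 1) U j) x κ ∈ U1 𝔸)
  (hreg : ∀ (j : ℕ) (y : TSite d (towerP L m j)) (κ : Fin d) (r : Fin d → Fin L),
    ‖((Wcx L (perCfg (towerP L m (j + 1)) (B9Eq315QTower.UlevOf L m (n + 1) U j)) (cornerSite L y) κ (boxVec L r) : 𝔸ˣ) : 𝔸) - 1‖ ≤ α j)
  (a : ℝ) {χ : TSite d (towerP L m (n + 1)) → ℝ} {χ' : TSite d m → ℝ}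
  {MB : BondL2K ℂ d (towerP L m (n + 1)) c₀ W →L[ℂ] BondL2K ℂ d (towerP L m (n + 1)) c₀ W}
  (hMB : ∀ (g : BondL2K ℂ d (towerP L m (n + 1)) c₀ W) (b : Bond d (towerP L m (n + 1))),
    WL2.equiv ℂ (fun _ : Bond d (towerP L m (n + 1)) => c₀) W (MB g) b = (χ (bpos b) : ℂ) • WL2.equiv ℂ (fun _ : Bond d (towerP L m (n + 1)) => c₀) W g b)
  {MP : PlaqL2K ℂ d (towerP L m (n + 1)) c₀ W →L[ℂ] PlaqL2K ℂ d (towerP L m (n + 1)) c₀ W}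
  (hMP : ∀ (g : PlaqL2K ℂ d (towerP L m (n + 1)) c₀ W) (p : B9SectCLatticeCarrier.Plaq d (towerP L m (n + 1))),
    WL2.equiv ℂ (fun _ : B9SectCLatticeCarrier.Plaq d (towerP L m (n + 1)) => c₀) W (MP g) p =
      (χ p.1 : ℂ) • WL2.equiv ℂ (fun _ : B9SectCLatticeCarrier.Plaq d (towerP L m (n + 1)) => c₀) W g p)
  {MS : SiteL2K ℂ d (towerP L m (n + 1)) c₀ W →L[ℂ] SiteL2K ℂ d (towerP L m (n + 1)) c₀ W}
  (hMS : ∀ (g : SiteL2K ℂ d (towerP L m (n + 1)) c₀ W) (x : TSite d (towerP L m (n + 1))),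
    WL2.equiv ℂ (fun _ : TSite d (towerP L m (n + 1)) => c₀) W (MS g) x = (χ x : ℂ) • WL2.equiv ℂ (fun _ : TSite d (towerP L m (n + 1)) => c₀) W g x)
  {MF : BondL2K ℂ d m c₁ W →L[ℂ] BondL2K ℂ d m c₁ W}
  (hMF : ∀ (g : BondL2K ℂ d m c₁ W) (b' : Bond d m),
    WL2.equiv ℂ (fun _ : Bond d m => c₁) W (MF g) b' = (χ' (bpos b') : ℂ) • WL2.equiv ℂ (fun _ : Bond d m => c₁) W g b')

include hφ hφ' hMφ hMφ' hη hU hRS hMB hMP hMS hMF in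
/-- **THE CONJUGATED TOWER BOND PROPAGATOR AT ONE `κ` OF THE CIRCLE `‖κ‖ = r`**: `‖exp(κ•M_B) ∘ G₁,k(U) ∘ exp(−κ•M_B)‖ ≤ 4∕γ` — `norm_conjG1k_le` at the operator
exponentials of the fine multipliers (pointwise `e^{±κχ}` by (G)) with `Q_κ := e^{κM_F}Q_k(U)e^{−κM_B}`, `Q′_κ := e^{κM_B}Q_k(U)†e^{−κM_F}` (coarse multiplier `M_F` by the
companion `χ′(b′₋)`; factorisation by `e^{−κM_F}e^{κM_F} = 1`), radius windows, the four conjugation letters `dQ, dQ′, dK, dR` displayed AT THIS `κ` in the shape of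
`B9Eq3126QG1QInvPointDecayTower`'s `hQK`, `C_P` displayed.
[cite: Balaban1985BackgroundPropagators, (3.26) p.395, Thm 3.11 p.416, (3.49) p.399; Balaban1985Variational, (110) p.294] -/
theorem norm_conjG1k_le_of_circle (ha : 0 ≤ a)
    (hpos : ∀ x : BondL2K ℂ d (towerP L m (n + 1)) c₀ W, x ≠ 0 → 0 < RCLike.re ⟪x, laplaceAk L m n φ η U hL α hα1 hU1 hreg τ (c₀ := c₀) (c₁ := c₁) a x⟫_ℂ)
    {γ β βK pK ℓ r ρ CP : ℝ} (hγ : 0 < γ) (hβ : 0 ≤ β) (hℓ : 0 ≤ ℓ) (hρ : 0 ≤ ρ) (hρ8 : ρ ≤ 1 / 8) (hCP : 0 ≤ CP)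
    (hcoer : ∀ f : BondL2K ℂ d (towerP L m (n + 1)) c₀ W, γ * ‖f‖ ^ 2 ≤ RCLike.re ⟪f, laplaceAk L m n φ η U hL α hα1 hU1 hreg τ (c₀ := c₀) (c₁ := c₁) a f⟫_ℂ)
    (hKre : ∀ f : BondL2K ℂ d (towerP L m (n + 1)) c₀ W, -(pK * ‖f‖ ^ 2) ≤ RCLike.re ⟪f, curvOp φ τ η U f⟫_ℂ)
    (hχ : ∀ b : Bond d (towerP L m (n + 1)), |χ (bpos b) - χ (btgt b)| ≤ ℓ * η) (hwin : r * ℓ * η ≤ 1)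
    (hβCC : 4 * r * ℓ * (Mφ * Mφ') * (d * Real.sqrt d) ≤ β) (hβC : 4 * r * ℓ * (Mφ * Mφ') * d ≤ β)
    (hβD : 2 * r * ℓ * (Mφ * Mφ') * Real.sqrt d ≤ β)
    (hP : ∀ f, ‖covDivL2K ℂ c₀ ((η : ℂ))⁻¹ (adTransportW φ fun b => (U b)⁻¹) f -
      RofUk L m n φ η U (c₀ := c₀) (covDivL2K ℂ c₀ ((η : ℂ))⁻¹ (adTransportW φ fun b => (U b)⁻¹) f)‖ ≤ CP * ‖f‖)
    (small : pK / 2 + (21 + 3 * a) * β ^ 2 + 4 * β * CP + 2 * ρ * CP ^ 2 + βK ≤ γ / 4) (κ : ℂ) (hκr : ‖κ‖ = r)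
    (dQ : ∀ f, ‖exp (κ • MF) ((QkW L m n φ U hL α hα1 hU1 hreg (c₀ := c₀) (c₁ := c₁)) (exp (κ • (-MB)) f)) - (QkW L m n φ U hL α hα1 hU1 hreg (c₀ := c₀) (c₁ := c₁)) f‖ ≤ β * ‖f‖)
    (dQ' : ∀ g, ‖exp (κ • MB) (LinearMap.adjoint (QkW L m n φ U hL α hα1 hU1 hreg (c₀ := c₀) (c₁ := c₁)) (exp (κ • (-MF)) g)) - LinearMap.adjoint (QkW L m n φ U hL α hα1 hU1 hreg (c₀ := c₀) (c₁ := c₁)) g‖ ≤ β * ‖g‖)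
    (dK : ∀ f, ‖exp (κ • MB) (curvOp φ τ η U (exp (κ • (-MB)) f)) - curvOp φ τ η U f‖ ≤ βK * ‖f‖)
    (dR : ∀ s, ‖exp (κ • MS) (RofUk L m n φ η U (c₀ := c₀) (exp (κ • (-MS)) s)) - RofUk L m n φ η U (c₀ := c₀) s‖ ≤ ρ * ‖s‖) :
    ‖exp (κ • MB) ∘L LinearMap.toContinuousLinearMap (G1k L m n φ η U hL α hα1 hU1 hreg τ (c₀ := c₀) (c₁ := c₁) hpos) ∘L exp (κ • (-MB))‖ ≤ 4 / γ := by
  refine ContinuousLinearMap.opNorm_le_bound _ (by positivity) fun v => ?_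
  -- the six multipliers at this `κ`, as linear maps with their pointwise actions
  have hS : ∀ (g : BondL2K ℂ d (towerP L m (n + 1)) c₀ W) (b : Bond d (towerP L m (n + 1))),
      WL2.equiv ℂ (fun _ : Bond d (towerP L m (n + 1)) => c₀) W
          (((exp (κ • MB) : BondL2K ℂ d (towerP L m (n + 1)) c₀ W →L[ℂ] BondL2K ℂ d (towerP L m (n + 1)) c₀ W) :
            BondL2K ℂ d (towerP L m (n + 1)) c₀ W →ₗ[ℂ] BondL2K ℂ d (towerP L m (n + 1)) c₀ W) g) b =
        Complex.exp (κ * (χ (bpos b) : ℂ)) • WL2.equiv ℂ (fun _ : Bond d (towerP L m (n + 1)) => c₀) W g b :=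
    fun g b => equiv_exp_smul_apply_complex MB (fun b => χ (bpos b)) hMB κ g b
  have hSinv : ∀ (g : BondL2K ℂ d (towerP L m (n + 1)) c₀ W) (b : Bond d (towerP L m (n + 1))),
      WL2.equiv ℂ (fun _ : Bond d (towerP L m (n + 1)) => c₀) W
          (((exp (κ • (-MB)) : BondL2K ℂ d (towerP L m (n + 1)) c₀ W →L[ℂ] BondL2K ℂ d (towerP L m (n + 1)) c₀ W) :
            BondL2K ℂ d (towerP L m (n + 1)) c₀ W →ₗ[ℂ] BondL2K ℂ d (towerP L m (n + 1)) c₀ W) g) b =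
        Complex.exp (-(κ * (χ (bpos b) : ℂ))) • WL2.equiv ℂ (fun _ : Bond d (towerP L m (n + 1)) => c₀) W g b :=
    fun g b => equiv_exp_smul_neg_apply_complex MB (fun b => χ (bpos b)) hMB κ g b
  have hSP : ∀ (g : PlaqL2K ℂ d (towerP L m (n + 1)) c₀ W) (p : B9SectCLatticeCarrier.Plaq d (towerP L m (n + 1))),
      WL2.equiv ℂ (fun _ : B9SectCLatticeCarrier.Plaq d (towerP L m (n + 1)) => c₀) W
          (((exp (κ • MP) : PlaqL2K ℂ d (towerP L m (n + 1)) c₀ W →L[ℂ] PlaqL2K ℂ d (towerP L m (n + 1)) c₀ W) :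
            PlaqL2K ℂ d (towerP L m (n + 1)) c₀ W →ₗ[ℂ] PlaqL2K ℂ d (towerP L m (n + 1)) c₀ W) g) p =
        Complex.exp (κ * (χ p.1 : ℂ)) • WL2.equiv ℂ (fun _ : B9SectCLatticeCarrier.Plaq d (towerP L m (n + 1)) => c₀) W g p :=
    fun g p => equiv_exp_smul_apply_complex MP (fun p : B9SectCLatticeCarrier.Plaq d (towerP L m (n + 1)) => χ p.1) hMP κ g p
  have hSPinv : ∀ (g : PlaqL2K ℂ d (towerP L m (n + 1)) c₀ W) (p : B9SectCLatticeCarrier.Plaq d (towerP L m (n + 1))),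
      WL2.equiv ℂ (fun _ : B9SectCLatticeCarrier.Plaq d (towerP L m (n + 1)) => c₀) W
          (((exp (κ • (-MP)) : PlaqL2K ℂ d (towerP L m (n + 1)) c₀ W →L[ℂ] PlaqL2K ℂ d (towerP L m (n + 1)) c₀ W) :
            PlaqL2K ℂ d (towerP L m (n + 1)) c₀ W →ₗ[ℂ] PlaqL2K ℂ d (towerP L m (n + 1)) c₀ W) g) p =
        Complex.exp (-(κ * (χ p.1 : ℂ))) • WL2.equiv ℂ (fun _ : B9SectCLatticeCarrier.Plaq d (towerP L m (n + 1)) => c₀) W g p :=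
    fun g p => equiv_exp_smul_neg_apply_complex MP (fun p : B9SectCLatticeCarrier.Plaq d (towerP L m (n + 1)) => χ p.1) hMP κ g p
  have hSS : ∀ (g : SiteL2K ℂ d (towerP L m (n + 1)) c₀ W) (x : TSite d (towerP L m (n + 1))),
      WL2.equiv ℂ (fun _ : TSite d (towerP L m (n + 1)) => c₀) W
          (((exp (κ • MS) : SiteL2K ℂ d (towerP L m (n + 1)) c₀ W →L[ℂ] SiteL2K ℂ d (towerP L m (n + 1)) c₀ W) :
            SiteL2K ℂ d (towerP L m (n + 1)) c₀ W →ₗ[ℂ] SiteL2K ℂ d (towerP L m (n + 1)) c₀ W) g) x =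
        Complex.exp (κ * (χ x : ℂ)) • WL2.equiv ℂ (fun _ : TSite d (towerP L m (n + 1)) => c₀) W g x :=
    fun g x => equiv_exp_smul_apply_complex MS χ hMS κ g x
  have hSSinv : ∀ (g : SiteL2K ℂ d (towerP L m (n + 1)) c₀ W) (x : TSite d (towerP L m (n + 1))),
      WL2.equiv ℂ (fun _ : TSite d (towerP L m (n + 1)) => c₀) W
          (((exp (κ • (-MS)) : SiteL2K ℂ d (towerP L m (n + 1)) c₀ W →L[ℂ] SiteL2K ℂ d (towerP L m (n + 1)) c₀ W) :
            SiteL2K ℂ d (towerP L m (n + 1)) c₀ W →ₗ[ℂ] SiteL2K ℂ d (towerP L m (n + 1)) c₀ W) g) x =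
        Complex.exp (-(κ * (χ x : ℂ))) • WL2.equiv ℂ (fun _ : TSite d (towerP L m (n + 1)) => c₀) W g x :=
    fun g x => equiv_exp_smul_neg_apply_complex MS χ hMS κ g x
  -- the windows and the displayed letters at this `κ`
  have hwinκ : ‖κ‖ * ℓ * η ≤ 1 := by rw [hκr]; exact hwin
  have hβCC' : 4 * ‖κ‖ * ℓ * (Mφ * Mφ') * (d * Real.sqrt d) ≤ β := by rw [hκr]; exact hβCC
  have hβC' : 4 * ‖κ‖ * ℓ * (Mφ * Mφ') * d ≤ β := by rw [hκr]; exact hβC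
  have hβD' : 2 * ‖κ‖ * ℓ * (Mφ * Mφ') * Real.sqrt d ≤ β := by rw [hκr]; exact hβD
  -- the coarse multipliers and the factorisation `e^{κM_B}Q_k†(a•Q_k)e^{−κM_B} = a•(e^{κM_B}Q_k†e^{−κM_F})((e^{κM_F}Q_ke^{−κM_B})·)`
  have hSF : ∀ (g : BondL2K ℂ d m c₁ W) (b' : Bond d m),
      WL2.equiv ℂ (fun _ : Bond d m => c₁) W
          (((exp (κ • MF) : BondL2K ℂ d m c₁ W →L[ℂ] BondL2K ℂ d m c₁ W) : BondL2K ℂ d m c₁ W →ₗ[ℂ] BondL2K ℂ d m c₁ W) g) b' =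
        Complex.exp (κ * (χ' (bpos b') : ℂ)) • WL2.equiv ℂ (fun _ : Bond d m => c₁) W g b' :=
    fun g b' => equiv_exp_smul_apply_complex MF (fun b' => χ' (bpos b')) hMF κ g b'
  have hSFinv : ∀ (g : BondL2K ℂ d m c₁ W) (b' : Bond d m),
      WL2.equiv ℂ (fun _ : Bond d m => c₁) W
          (((exp (κ • (-MF)) : BondL2K ℂ d m c₁ W →L[ℂ] BondL2K ℂ d m c₁ W) : BondL2K ℂ d m c₁ W →ₗ[ℂ] BondL2K ℂ d m c₁ W) g) b' =
        Complex.exp (-(κ * (χ' (bpos b') : ℂ))) • WL2.equiv ℂ (fun _ : Bond d m => c₁) W g b' :=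
    fun g b' => equiv_exp_smul_neg_apply_complex MF (fun b' => χ' (bpos b')) hMF κ g b'
  have hSFi := apply_inv_apply' κ (fun b' : Bond d m => χ' (bpos b')) hSF hSFinv
  have h := norm_conjG1k_le L m n φ hφ hφ' hMφ hMφ' hη U hU hRS τ hL α hα1 hU1 hreg a
    (S := ((exp (κ • MB) : BondL2K ℂ d (towerP L m (n + 1)) c₀ W →L[ℂ] BondL2K ℂ d (towerP L m (n + 1)) c₀ W) : BondL2K ℂ d (towerP L m (n + 1)) c₀ W →ₗ[ℂ] BondL2K ℂ d (towerP L m (n + 1)) c₀ W))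
    (Sinv := ((exp (κ • (-MB)) : BondL2K ℂ d (towerP L m (n + 1)) c₀ W →L[ℂ] BondL2K ℂ d (towerP L m (n + 1)) c₀ W) : BondL2K ℂ d (towerP L m (n + 1)) c₀ W →ₗ[ℂ] BondL2K ℂ d (towerP L m (n + 1)) c₀ W))
    hS hSinv hSP hSPinv hSS hSSinv ha hpos hγ hβ hℓ hρ hρ8 hCP hcoer hKre hχ hwinκ hβCC' hβC' hβD'
    (((exp (κ • MF) : BondL2K ℂ d m c₁ W →L[ℂ] BondL2K ℂ d m c₁ W) : BondL2K ℂ d m c₁ W →ₗ[ℂ] BondL2K ℂ d m c₁ W) ∘ₗ (QkW L m n φ U hL α hα1 hU1 hreg (c₀ := c₀) (c₁ := c₁)) ∘ₗ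
      ((exp (κ • (-MB)) : BondL2K ℂ d (towerP L m (n + 1)) c₀ W →L[ℂ] BondL2K ℂ d (towerP L m (n + 1)) c₀ W) : BondL2K ℂ d (towerP L m (n + 1)) c₀ W →ₗ[ℂ] BondL2K ℂ d (towerP L m (n + 1)) c₀ W))
    (((exp (κ • MB) : BondL2K ℂ d (towerP L m (n + 1)) c₀ W →L[ℂ] BondL2K ℂ d (towerP L m (n + 1)) c₀ W) : BondL2K ℂ d (towerP L m (n + 1)) c₀ W →ₗ[ℂ] BondL2K ℂ d (towerP L m (n + 1)) c₀ W) ∘ₗ LinearMap.adjoint (QkW L m n φ U hL α hα1 hU1 hreg (c₀ := c₀) (c₁ := c₁)) ∘ₗ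
      ((exp (κ • (-MF)) : BondL2K ℂ d m c₁ W →L[ℂ] BondL2K ℂ d m c₁ W) : BondL2K ℂ d m c₁ W →ₗ[ℂ] BondL2K ℂ d m c₁ W))
    (fun f => by
      have e := hSFi ((QkW L m n φ U hL α hα1 hU1 hreg (c₀ := c₀) (c₁ := c₁)) ((exp (κ • (-MB)) : BondL2K ℂ d (towerP L m (n + 1)) c₀ W →L[ℂ] BondL2K ℂ d (towerP L m (n + 1)) c₀ W) f))
      simp only [ContinuousLinearMap.coe_coe] at e
      simp only [LinearMap.comp_apply, ContinuousLinearMap.coe_coe, map_smul, e])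
    (fun f => by simpa only [LinearMap.comp_apply, ContinuousLinearMap.coe_coe] using dQ f)
    (fun g => by simpa only [LinearMap.comp_apply, ContinuousLinearMap.coe_coe] using dQ' g)
    (fun f => by simpa only [LinearMap.comp_apply, ContinuousLinearMap.coe_coe] using dK f)
    (fun s => by simpa only [LinearMap.comp_apply, ContinuousLinearMap.coe_coe] using dR s) hP small v
  simpa only [ContinuousLinearMap.comp_apply, LinearMap.coe_toContinuousLinearMap', LinearMap.comp_apply, ContinuousLinearMap.coe_coe] using h

end Circle

/-! ## §2 The instance: big-block decay of `G₁,k(U)` on the tower, every height, letters with companion -/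

section Instance

variable {d : ℕ} {L : ℕ} [NeZero L] {m : Fin d → ℕ} [∀ i, NeZero (m i)] {n : ℕ}
  {𝔸 : Type*} [NormedRing 𝔸] [StarRing 𝔸] [NormedAlgebra ℂ 𝔸] [StarModule ℂ 𝔸] [CompleteSpace 𝔸] [NormOneClass 𝔸]
  {W : Type*} [NormedAddCommGroup W] [InnerProductSpace ℂ W] [FiniteDimensional ℂ W] (φ : W ≃ₗ[ℂ] 𝔸) {Mφ Mφ' : ℝ}
  (hφ : ∀ w, ‖φ w‖ ≤ Mφ * ‖w‖) (hφ' : ∀ X, ‖φ.symm X‖ ≤ Mφ' * ‖X‖) (hMφ : 0 ≤ Mφ) (hMφ' : 0 ≤ Mφ')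
  {c₀ : ℝ} [Fact (0 < c₀)] {c₁ : ℝ} [Fact (0 < c₁)] {η : ℝ} (hη : 0 < η) (hηL : η * (L : ℝ) ^ (n + 1) = 1)
  (U : Bond d (towerP L m (n + 1)) → 𝔸ˣ) (hU : ∀ b, U b ∈ U1 𝔸)
  (hRS : ∀ (b : Bond d (towerP L m (n + 1))) (v u : W), ⟪adTransportW φ U b v, u⟫_ℂ = ⟪v, adTransportW φ (fun b => (U b)⁻¹) b u⟫_ℂ)
  (τ : 𝔸 →ₗ[ℂ] ℂ) (hL : 1 ≤ L) (α : ℕ → ℝ) (hα1 : ∀ j, α j ≤ 1 / 64)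
  (hU1 : ∀ (j : ℕ) (x : B7Prop1Explicit.Site d) (κ : Fin d), perCfg (towerP L m (j + 1)) (B9Eq315QTower.UlevOf L m (n + 1) U j) x κ ∈ U1 𝔸)
  (hreg : ∀ (j : ℕ) (y : TSite d (towerP L m j)) (κ : Fin d) (r : Fin d → Fin L),
    ‖((Wcx L (perCfg (towerP L m (j + 1)) (B9Eq315QTower.UlevOf L m (n + 1) U j)) (cornerSite L y) κ (boxVec L r) : 𝔸ˣ) : 𝔸) - 1‖ ≤ α j)
  (a : ℝ)

include hφ hφ' hMφ hMφ' hη hηL hU hRS in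
/-- **THE BIG-BLOCK `L²` DECAY OF `G₁,k(U) = Δ_{a,k}(U)⁻¹`, EVERY HEIGHT `n`**: on the tower at the diagonal `ηL^{n+1} = 1`, for every background with
`U(b) ∈ U1` and mutually adjoint transports, given the `γ`-coercivity of `Δ_{a,k}` (Thm 3.11), the `Δ′` floor `p_K`, the complementary-projection letter `C_P`,
the radius windows (`1 ≤ ℓ`, `rℓη ≤ 1`, `4rℓM_φM_φ′d√d ≤ β`, `4rℓM_φM_φ′d ≤ β`, `2rℓM_φM_φ′√d ≤ β`, `ρ ≤ 1∕8`, `p_K∕2 + (21+3a)β² + 4βC_P + 2ρC_P² + β_K ≤ γ∕4`)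
and the conjugated `Q_k` ∕ `Δ′` ∕ `R_k(U)` letters UNIFORMLY over the site weights with bond increments `≤ ℓη` and the circle `‖κ‖ = r` (displayed): for every
bond big-block family `P` (`Π = blockCoord (L^{n+1}) m ∘ siteCast ∘ bpos`) and every pair of unit-lattice sites
`‖P_{y₁} ∘ G₁,k(U) ∘ P_{y₀}‖ ≤ (4∕γ)·e^{r}·e^{−r·d_m(y₀,y₁)}`. [cite: Balaban1985BackgroundPropagators, (3.26) p.395, Thm 3.11 p.416, (3.49) p.399; Balaban1985Variational, (110) p.294] -/
theorem norm_block_G1k_le (ha : 0 ≤ a) (hm : ∀ i, 1 ≤ m i)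
    (hpos : ∀ x : BondL2K ℂ d (towerP L m (n + 1)) c₀ W, x ≠ 0 →
      0 < RCLike.re ⟪x, laplaceAk L m n φ η U hL α hα1 hU1 hreg τ (c₀ := c₀) (c₁ := c₁) a x⟫_ℂ)
    {γ β βK pK ℓ ℓ' r ρ CP : ℝ} (hγ : 0 < γ) (hβ : 0 ≤ β) (hℓ : 1 ≤ ℓ) (hℓ' : 1 ≤ ℓ') (hr : 0 ≤ r) (hρ : 0 ≤ ρ) (hρ8 : ρ ≤ 1 / 8)
    (hCP : 0 ≤ CP)
    (hcoer : ∀ f : BondL2K ℂ d (towerP L m (n + 1)) c₀ W, γ * ‖f‖ ^ 2 ≤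
      RCLike.re ⟪f, laplaceAk L m n φ η U hL α hα1 hU1 hreg τ (c₀ := c₀) (c₁ := c₁) a f⟫_ℂ)
    (hKre : ∀ f : BondL2K ℂ d (towerP L m (n + 1)) c₀ W, -(pK * ‖f‖ ^ 2) ≤ RCLike.re ⟪f, curvOp φ τ η U f⟫_ℂ)
    (hwin : r * ℓ * η ≤ 1)
    (hβCC : 4 * r * ℓ * (Mφ * Mφ') * (d * Real.sqrt d) ≤ β) (hβC : 4 * r * ℓ * (Mφ * Mφ') * d ≤ β)
    (hβD : 2 * r * ℓ * (Mφ * Mφ') * Real.sqrt d ≤ β)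
    (hQK : ∀ (χ : TSite d (towerP L m (n + 1)) → ℝ) (χ' : TSite d m → ℝ),
      (∀ b : Bond d (towerP L m (n + 1)), |χ (bpos b) - χ (btgt b)| ≤ ℓ * η) →
      (∀ (y : TSite d m) (x : TSite d (towerP L m (n + 1))),
        siteCast (towerP_eq_fineP_pow L m (n + 1)) x ∈ B9Eq319QprimeTorus.blockOf (L ^ (n + 1)) m y → |χ' y - χ x| ≤ ℓ') →
      ∀ (MB : BondL2K ℂ d (towerP L m (n + 1)) c₀ W →L[ℂ] BondL2K ℂ d (towerP L m (n + 1)) c₀ W),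
      (∀ (g : BondL2K ℂ d (towerP L m (n + 1)) c₀ W) (b : Bond d (towerP L m (n + 1))),
        WL2.equiv ℂ (fun _ : Bond d (towerP L m (n + 1)) => c₀) W (MB g) b = (χ (bpos b) : ℂ) • WL2.equiv ℂ (fun _ : Bond d (towerP L m (n + 1)) => c₀) W g b) →
      ∀ (MS : SiteL2K ℂ d (towerP L m (n + 1)) c₀ W →L[ℂ] SiteL2K ℂ d (towerP L m (n + 1)) c₀ W),
      (∀ (g : SiteL2K ℂ d (towerP L m (n + 1)) c₀ W) (x : TSite d (towerP L m (n + 1))),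
        WL2.equiv ℂ (fun _ : TSite d (towerP L m (n + 1)) => c₀) W (MS g) x = (χ x : ℂ) • WL2.equiv ℂ (fun _ : TSite d (towerP L m (n + 1)) => c₀) W g x) →
      ∀ (MF : BondL2K ℂ d m c₁ W →L[ℂ] BondL2K ℂ d m c₁ W),
      (∀ (g : BondL2K ℂ d m c₁ W) (b' : Bond d m),
        WL2.equiv ℂ (fun _ : Bond d m => c₁) W (MF g) b' = (χ' (bpos b') : ℂ) • WL2.equiv ℂ (fun _ : Bond d m => c₁) W g b') →
      ∀ κ : ℂ, ‖κ‖ = r →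
      (∀ f, ‖exp (κ • MF) ((QkW L m n φ U hL α hα1 hU1 hreg (c₀ := c₀) (c₁ := c₁)) (exp (κ • (-MB)) f)) - (QkW L m n φ U hL α hα1 hU1 hreg (c₀ := c₀) (c₁ := c₁)) f‖ ≤ β * ‖f‖) ∧
      (∀ g, ‖exp (κ • MB) (LinearMap.adjoint (QkW L m n φ U hL α hα1 hU1 hreg (c₀ := c₀) (c₁ := c₁)) (exp (κ • (-MF)) g)) - LinearMap.adjoint (QkW L m n φ U hL α hα1 hU1 hreg (c₀ := c₀) (c₁ := c₁)) g‖ ≤ β * ‖g‖) ∧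
      (∀ f, ‖exp (κ • MB) (curvOp φ τ η U (exp (κ • (-MB)) f)) - curvOp φ τ η U f‖ ≤ βK * ‖f‖) ∧
      (∀ s, ‖exp (κ • MS) (RofUk L m n φ η U (c₀ := c₀) (exp (κ • (-MS)) s)) - RofUk L m n φ η U (c₀ := c₀) s‖ ≤ ρ * ‖s‖))
    (hP : ∀ f, ‖covDivL2K ℂ c₀ ((η : ℂ))⁻¹ (adTransportW φ fun b => (U b)⁻¹) f -
      RofUk L m n φ η U (c₀ := c₀) (covDivL2K ℂ c₀ ((η : ℂ))⁻¹ (adTransportW φ fun b => (U b)⁻¹) f)‖ ≤ CP * ‖f‖)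
    (small : pK / 2 + (21 + 3 * a) * β ^ 2 + 4 * β * CP + 2 * ρ * CP ^ 2 + βK ≤ γ / 4)
    (PB : TSite d m → BondL2K ℂ d (towerP L m (n + 1)) c₀ W →L[ℂ] BondL2K ℂ d (towerP L m (n + 1)) c₀ W)
    (hPB : ∀ (y : TSite d m) (f : BondL2K ℂ d (towerP L m (n + 1)) c₀ W) (b : Bond d (towerP L m (n + 1))),
      WL2.equiv ℂ (fun _ : Bond d (towerP L m (n + 1)) => c₀) W (PB y f) b =
        if blockCoord (L ^ (n + 1)) m (siteCast (towerP_eq_fineP_pow L m (n + 1)) (bpos b)) = y then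
          WL2.equiv ℂ (fun _ : Bond d (towerP L m (n + 1)) => c₀) W f b else 0)
    (y₀ y₁ : TSite d m) :
    ‖PB y₁ ∘L LinearMap.toContinuousLinearMap (G1k L m n φ η U hL α hα1 hU1 hreg τ (c₀ := c₀) (c₁ := c₁) hpos) ∘L PB y₀‖ ≤
      4 / γ * Real.exp r * Real.exp (-(r * tdist m y₀ y₁)) := by
  have hL0 : (0 : ℝ) < L := by exact_mod_cast Nat.pos_of_ne_zero (NeZero.ne L)
  have hLp : (0 : ℝ) < (L : ℝ) ^ (n + 1) := pow_pos hL0 _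
  have hι : 1 / ((L ^ (n + 1) : ℕ) : ℝ) ≤ ℓ * η := by
    rw [Nat.cast_pow, div_le_iff₀ hLp]
    calc (1 : ℝ) = 1 * (η * (L : ℝ) ^ (n + 1)) := by rw [hηL, mul_one]
      _ ≤ ℓ * (η * (L : ℝ) ^ (n + 1)) := by gcongr
      _ = ℓ * η * (L : ℝ) ^ (n + 1) := by ring
  refine norm_bondBlock_le_exp_of_uniform_circle_bound_cast m (towerP_eq_fineP_pow L m (n + 1)) hm _ hPB hr (by positivity) hι hℓ'
    (fun χ χ' hχ hχ' MB hMB κ hκr => ?_) y₀ y₁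
  -- the plaquette, site and coarse multipliers of this weight pair, the letters at this `κ`, then §1
  obtain ⟨MP, hMP⟩ := exists_pointwise_clm (𝕜 := ℂ) (w := fun _ : B9SectCLatticeCarrier.Plaq d (towerP L m (n + 1)) => c₀) (V := W)
    (fun p : B9SectCLatticeCarrier.Plaq d (towerP L m (n + 1)) => p.1) χ
  obtain ⟨MS, hMS⟩ := exists_pointwise_clm (𝕜 := ℂ) (w := fun _ : TSite d (towerP L m (n + 1)) => c₀) (V := W)
    (fun x : TSite d (towerP L m (n + 1)) => x) χ
  obtain ⟨MF, hMF⟩ := exists_pointwise_clm (𝕜 := ℂ) (w := fun _ : Bond d m => c₁) (V := W) (fun b' : Bond d m => bpos b') (fun y => χ' y)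
  obtain ⟨dQ, dQ', dK, dR⟩ := hQK χ χ' hχ hχ' MB hMB MS hMS MF hMF κ hκr
  exact norm_conjG1k_le_of_circle L m n φ hφ hφ' hMφ hMφ' hη U hU hRS τ hL α hα1 hU1 hreg a hMB hMP hMS hMF ha hpos hγ hβ (zero_le_one.trans hℓ) hρ hρ8
    hCP hcoer hKre hχ hwin hβCC hβC hβD hP small κ hκr dQ dQ' dK dR

end Instance

end Literature.MathematicalPhysics.QuantumFieldTheory.Balaban1983to89.B9Eq326DeltaABlockDecayTower

end
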